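import Literature.MathematicalPhysics.QuantumFieldTheory.Balaban1983to89.B4Prop23WindowBounds
import Literature.MathematicalPhysics.QuantumFieldTheory.Balaban1983to89.B4Prop23RegularFamily
import Literature.MathematicalPhysics.QuantumFieldTheory.Balaban1983to89.B4Eq12ExpFlow

/-!
# `Balaban1983to89.B4Prop23RegularWindow` — T. Bałaban, *Regularity and decay of lattice Green's functions*, Commun.
# Math. Phys. **89** (1983) 571–597 [Balaban1983RegularityDecay] (= B4): «Proposition 2.3 of [1]» (1.15)–(1.20) p. 574
# PROVED AT A REGULAR `A ≠ 0` WITH ONE SET OF CONSTANTS FOR ALL `a_k ∈ [a₋, a₊]` — the leaf `B4.Prop23Printed` on the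
# regular-field nested-region family indexed ALSO by `a_k` in a window

statement-level skeleton of published theorems with citation tags; proofs where landed; nothing here is a claim about the Yang–Mills mass gap

PDF held: `paper:balaban1983-cmp89-regularity-decay` (journal page = PDF page + 570); pp. 573–574, 593–594 [PDF 3–4,
23–24] read on the ×2 renders `…/b2b-balaban-ref1/pages/1983-cmp89-regularity-decay/…-p0NN-x2.png`.

CITATION HEADER (lean-in-tree rule).  Cell `lit-balaban` (HOME `run/shared/lean/pub/lit-balaban/`), Phase-2 proof seat
**p17** gen 3 (unit `lit-balaban-p17-g3`), file 8c — row **B4.Prop2.3[I]** («Proposition 2.3 of [1]», `B4.Prop23Printed`;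
owner r01, referee ref-4) and B1's original Prop. 2.3 (`B1.Prop23Intended`, r14): CLOSES the HONEST-SCOPE item
**G-B4-p17-01** of GAPS.md («a_k-window uniformity NOT asserted by the A ≠ 0 leaf — each a_k indexes a separate family»).
p. 574 (verbatim): *"There exist positive constants δ₀, c₀, γ₀, γ₁ dependent on d and M only and such that for e
sufficiently small and arbitrary Λ ⊂ Ω^{(k)} … we have γ₀⟨φ,φ⟩ ≤ ⟨φ, (Δ^{(k)}(Ω,A) + aL^{−2}P(A))φ⟩ ≤ γ₁⟨φ,φ⟩ (1.15) …
(1.16) … (1.18) … (1.20)"*; p. 573 (1.14): *"a_k is a constant proportional to a"* — along the induction over `k` the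
parameter `a_k` runs through a compact window of positive numbers, and the printed constants do not depend on `k`.

THE FAMILY (`RegularRegionIdxW`, `regularFieldRegionsW`): file 5's regular-field nested-region family
(`B4Prop23RegularFamily.regularFieldRegions`: every mesh `1/n`, mass `m² ∈ [0,m²₊]`, nested finite unions `Ω ⊆ Ω₀` of
`L`-blocks, every `Λ ⊆ Ω^{(k)} × {colours}`, every vector field with (1.7) on `Ω₀`, every charge) with the index now ALSO
carrying `a_k ∈ [a₋, a₊]`; the carrier at an index is file 5's carrier at that `a_k` (definitionally).

WHAT IS KERNEL-CHECKED (zero `sorry`, standard axioms, no `Prop`-valued definition):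
**`prop23Printed_regularWindow : B4.Prop23Printed (regularFieldRegionsW F hL a₋ a₊ a′ c β m²₊)`** — ONE `(δ₀, c₀, γ₀, γ₁,
e₁)` for the whole window: `γ₀ = γ₀″(a₋)`, `γ₁ = a₊ + a′L^{−2}`, `c₀ = c0W`, `δ₀ = d0W` (file 8b, the Sect. 5 Theorem at
the window constants `(γ₀″(a₋), cW, dW)` of file 8a), `e₁` = the minimum of the three window-uniform thresholds of file 8a
(`threshold_window`, `thresholdU_window`, `hX_window`); members from file 8b's `form115_window`,
`prop23_116_118_window`, `prop23_120_window` (+ file 5's `cLam_ambient_eq` for the faithfulness of (1.20) to `Ω₀`'s own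
operator).  Corollaries: `_rot` (rotation flow), `_exp` (flow `e^{tq}` of (1.2), any antisymmetric `q`, r01's
`B4Eq12ExpFlow.expFlow_lipschitz`), B1's Prop. 2.3 intended reading `prop23Intended_regularWindow` (+ `_exp`); non-vacuity
`linIdxW_meets`.  For `m²₊ < 0` the family is empty and the statement holds vacuously (handled).

HONEST SCOPE.  As files 2–8b: finite nested block unions (no infinite `Ω₀`, no torus); (1.7) on `Ω₀`; `|x−x′| = |·|_∞`;
`Λ^c`, `Ω^{(k)c}` read inside `Ω^{(k)}`, `Ω₀^{(k)}` (the literal-complement variant is file 6 `B4Prop23RegularFamilyLit`, not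
repeated here); the rate of the `δG` input halved (D-b04g14-3).  CONSTANTS depend on `(d, N, L, a₋, a₊, a′, c, β, ℓ, m²₊)`:
uniform in `a_k ∈ [a₋,a₊]` (this file), still `L`-dependent (the print's «d and M only» silently includes `L`, census
C-B5-5 / D-b04.4) and dependent on the fixed model constants.  `B4.Prop23Printed` is not a conjunct of `B4.LeafB4`;
value = kernel certificate of a published proposition at `A ≠ 0`, NOT summit progress.  Unit `lit-balaban-p17-g3`.
DOCFIX 2026-08-22 (lit-balaban-p17 gen 26, on r04 g22 `CITELOC-AUDIT-g22.md` §3, verified on the text layer of [Balaban1983RegularityDecay]): citation locators only — «(1.7) p.573» → «(1.7) p.572» at two `[cite:]` tags; every declaration byte-identical.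
-/

namespace Literature.MathematicalPhysics.QuantumFieldTheory.Balaban1983to89.B4Prop23RegularWindow

open Finset Matrix
open Literature.MathematicalPhysics.QuantumFieldTheory.Balaban1983to89
open Literature.MathematicalPhysics.QuantumFieldTheory.Balaban1983to89.B4GaugeCovariance (OrthFlow)
open Literature.MathematicalPhysics.QuantumFieldTheory.Balaban1983to89.B4Lower18Regular (e1 rot_lipschitz)
open Literature.MathematicalPhysics.QuantumFieldTheory.Balaban1983to89.B4Lower18 (fineDom)
open Literature.MathematicalPhysics.QuantumFieldTheory.Balaban1983to89.B4Sect5Torus (cSt_pos)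
open Literature.MathematicalPhysics.QuantumFieldTheory.Balaban1983to89.B4GaussRep36 (pOp cLam)
open Literature.MathematicalPhysics.QuantumFieldTheory.Balaban1983to89.B4Prop23ZeroBox (exp_bound_weaken)
open Literature.MathematicalPhysics.QuantumFieldTheory.Balaban1983to89.B4Cor23Rep36Bridge (hamR QkR)
open Literature.MathematicalPhysics.QuantumFieldTheory.Balaban1983to89.B4NextAvg52 (nextAvg)
open Literature.MathematicalPhysics.QuantumFieldTheory.Balaban1983to89.B4Ineq53RegularRegion (gam0 gamLow gamLow_pos)
open Literature.MathematicalPhysics.QuantumFieldTheory.Balaban1983to89.B4Prop23RegularRegion (rhoY rhoY_isPseudoDist)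
open Literature.MathematicalPhysics.QuantumFieldTheory.Balaban1983to89.B4Ineq120RegularAmbient (fine_sub)
open Literature.MathematicalPhysics.QuantumFieldTheory.Balaban1983to89.B4Ineq120RegularRegion (omegaY omegaY_nonneg)
open Literature.MathematicalPhysics.QuantumFieldTheory.Balaban1983to89.B4ConstantsWindow (gamLow_mono threshold_window
  thresholdU_window hX_window)
open Literature.MathematicalPhysics.QuantumFieldTheory.Balaban1983to89.B4Prop23WindowBounds (c0W d0W c0W_pos d0W_pos
  form115_window prop23_116_118_window prop23_120_window)
open Literature.MathematicalPhysics.QuantumFieldTheory.Balaban1983to89.B4Prop23RegularFamily (distCY distCY_nonneg distCY_le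
  lamEquiv RegularRegionIdx regularFieldRegions cLam_ambient_eq linIdx linIdx_meets)
open Literature.MathematicalPhysics.QuantumFieldTheory.Balaban1983to89.B4Eq12ExpFlow (expFlow expFlow_ell_nonneg
  expFlow_lipschitz)

noncomputable section

variable {d : ℕ} {ι : Type} [Fintype ι] [DecidableEq ι]

/-! ## §1. The family indexed also by `a_k ∈ [a₋, a₊]` -/

/-- ONE INSTANCE: a value `a_k ∈ [a₋, a₊]` of the (1.14)-parameter together with an instance of file 5's index (mesh, mass,
nested label sets, `Λ`, vector field, charge). [cite: Balaban1983RegularityDecay, (1.14) p.573 «a_k is a constant proportional to a», (1.13)–(1.20) pp.573–574] -/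
structure RegularRegionIdxW (d : ℕ) (ι : Type) (L : ℕ) (aminus aplus m2max : ℝ) where
  ak : ℝ
  hak : aminus ≤ ak
  hak' : ak ≤ aplus
  idx : RegularRegionIdx d ι L m2max

/-- **THE REGULAR-FIELD NESTED-REGION CARRIERS WITH `a_k` IN A WINDOW**: at the index `i` the carrier is file 5's
`regularFieldRegions F hL i.ak a′ c β m²₊ i.idx`. [cite: Balaban1983RegularityDecay, Prop. 2.3 of [1] (1.15)–(1.20) p.574, (1.14) p.573, dictionary] -/
def regularFieldRegionsW (F : OrthFlow ι) {L : ℕ} (hL : 1 ≤ L) (aminus aplus a' c β m2max : ℝ)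
    (i : RegularRegionIdxW d ι L aminus aplus m2max) : B4.UnitSetting :=
  regularFieldRegions F hL i.ak a' c β m2max i.idx

/-! ## §2. The leaf with window-uniform constants -/

section Leaf

variable (F : OrthFlow ι) {ℓ : ℝ} (hℓ : 0 ≤ ℓ)
  (hLip : ∀ t (v : ι → ℝ), ((F.U t - 1) *ᵥ v) ⬝ᵥ ((F.U t - 1) *ᵥ v) ≤ (ℓ * t) ^ 2 * (v ⬝ᵥ v))
  {L : ℕ} (hL : 1 ≤ L) {aminus aplus : ℝ} (ham : 0 < aminus) (hle : aminus ≤ aplus) {a' : ℝ} (ha' : 0 < a')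
  {c : ℝ} (hc : 0 ≤ c) {β : ℝ} (hβ : 0 < β) (m2max : ℝ)

include hℓ hLip ham hle ha' hc hβ in
/-- **LEAF: «PROPOSITION 2.3 OF [1]» (1.15)–(1.20) ON THE REGULAR-FIELD FAMILY (`A ≠ 0`), UNIFORMLY IN `a_k ∈ [a₋, a₊]`** —
`B4.Prop23Printed (regularFieldRegionsW F hL a₋ a₊ a′ c β m²₊)`: for a Lipschitz orthogonal flow, `L ≥ 1`, `0 < a₋ ≤ a₊`,
`a′ > 0`, `c ≥ 0`, `β > 0` THERE EXIST `δ₀, c₀, γ₀, γ₁, e₁ > 0` (explicit: `γ₀ = γ₀″(a₋)`, `γ₁ = a₊ + a′L^{−2}`, `c₀ = c0W`,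
`δ₀ = d0W`, `e₁` = min of the three window thresholds) such that for EVERY instance — every `a_k ∈ [a₋,a₊]`, every mesh,
every `m² ∈ [0,m²₊]`, every nested pair of finite unions of `L`-blocks, EVERY `Λ`, every vector field regular (1.7) on
`Ω₀`, every charge `0 < e ≤ e₁` — (1.15), (1.16), (1.17)–(1.18), (1.19)–(1.20) hold.
[cite: Balaban1983RegularityDecay, Prop. 2.3 of [1] (1.15)–(1.20) p.574 «constants dependent on d and M only»; (1.14) p.573; §5 pp.593–594] -/
theorem prop23Printed_regularWindow :
    B4.Prop23Printed (regularFieldRegionsW (d := d) F hL aminus aplus a' c β m2max) := by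
  rcases lt_or_ge m2max 0 with hneg | hm0
  · -- empty family: no mass `m² ∈ [0, m²₊]`
    refine ⟨1, 1, 1, 1, 1, one_pos, one_pos, one_pos, one_pos, one_pos, fun i => ?_⟩
    exact absurd (i.idx.hm.trans i.idx.hm') (not_le.2 hneg)
  have hL0 : (0 : ℝ) < L := by exact_mod_cast hL
  have hγ := gamLow_pos d hL aminus ha' m2max
  obtain ⟨e₁, he₁, h₁⟩ := threshold_window ℓ ((d + 1) * c) ham hle hβ d
  obtain ⟨e₂, he₂, h₂⟩ := thresholdU_window ℓ ((d + 1) * ((L : ℝ) ^ 2 * c)) ham hle ha' hβ d hm0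
  obtain ⟨e₃, he₃, h₃⟩ := hX_window ℓ c ham hle ha' hβ d L hL m2max
  have hc0 := c0W_pos (ι := ι) d hL aminus aplus ha' m2max
  have hd0 := d0W_pos (ι := ι) d hL ham hle ha' m2max
  refine ⟨d0W ι d L aminus aplus a' m2max, c0W ι d L aminus aplus a' m2max, gamLow d L aminus a' m2max,
    aplus + a' * ((L : ℝ) ^ 2)⁻¹, min e₁ (min e₂ e₃), hd0, hc0, hγ, by have := ham.trans_le hle; positivity,
    lt_min he₁ (lt_min he₂ he₃), ?_⟩
  intro i hreg _ he hle'
  change 0 < i.idx.e at he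
  change i.idx.e ≤ _ at hle'
  change ∀ x ∈ fineDom i.idx.n (fineDom L i.idx.Z₀c), ∀ μ ν : Fin (d + 1),
    |i.idx.Ac (x + e1 μ) ν - i.idx.Ac x ν| ≤ c * i.idx.e ^ (β - 1) / i.idx.n at hreg
  have ha : 0 < i.ak := ham.trans_le i.hak
  -- the smallness hypotheses of files 2–4 at the charge and the `a_k` of the instance
  have hsmall : ℓ ^ 2 * ((d + 1) * c * i.idx.e ^ β) ^ 2 * (d + 1) * (1 + i.ak * (d + 1)) ≤ min 2 i.ak / 4 := by
    have := h₁ i.idx.e he (hle'.trans (min_le_left _ _)) i.ak i.hak i.hak'; simpa only [mul_assoc] using this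
  have hsmallU : ℓ ^ 2 * ((d + 1) * ((L : ℝ) ^ 2 * c) * i.idx.e ^ β) ^ 2 * (d + 1)
      * (1 + (a' / gam0 d i.ak m2max) * (d + 1)) ≤ min 2 (a' / gam0 d i.ak m2max) / 4 := by
    have := h₂ i.idx.e he (hle'.trans ((min_le_right _ _).trans (min_le_left _ _))) i.ak i.hak i.hak'
    simpa only [mul_assoc] using this
  have hX := (h₃ i.idx.e he (hle'.trans ((min_le_right _ _).trans (min_le_right _ _))) i.ak i.hak i.hak' i.idx.m2
    i.idx.hm).trans (gamLow_mono d L ham i.hak hm0)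
  refine ⟨fun ψ => ?_, fun y y' => ?_, fun y y' => ?_, fun y y' => ?_⟩
  · -- (1.15)
    exact form115_window i.idx.hn hL i.idx.hsub F hℓ hLip he ham i.hak i.hak' ha' i.idx.hm i.idx.hm' hm0 hc hreg
      hsmall hsmallU hX ψ
  · -- (1.16)
    exact (prop23_116_118_window i.idx.hn hL i.idx.hsub F hℓ hLip he ham i.hak i.hak' ha' i.idx.hm i.idx.hm' hm0 hc
      hreg hsmall hsmallU hX i.idx.Λ).1 y y'
  · -- (1.17)–(1.18)
    exact (prop23_116_118_window i.idx.hn hL i.idx.hsub F hℓ hLip he ham i.hak i.hak' ha' i.idx.hm i.idx.hm' hm0 hc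
      hreg hsmall hsmallU hX i.idx.Λ).2 (fun y => distCY i.idx.Λ y.1) (fun y => distCY_nonneg i.idx.Λ y.1)
      (fun y z hz => distCY_le i.idx.Λ y.1 hz) y y'
  · -- (1.19)–(1.20)
    have h := prop23_120_window i.idx.hn hL i.idx.hsub F hℓ hLip he ham i.hak i.hak' ha' i.idx.hm i.idx.hm' hm0 hc
      hreg hsmall hsmallU hX i.idx.Λ y y'
    show |_ - cLam _ _ _ _ _ _ _ _ (lamEquiv hL i.idx.hsub i.idx.Λ y) (lamEquiv hL i.idx.hsub i.idx.Λ y')| ≤ _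
    rw [cLam_ambient_eq i.idx.hn hL i.idx.hsub hℓ hLip he ha i.idx.hm hc hreg hsmall]
    exact h

end Leaf

/-! ## §3. Flow instances, B1's original, non-vacuity -/

/-- **THE WINDOW LEAF FOR THE ROTATION FLOW** (`N = 2`, `ℓ = 1`): hypothesis-free flow instance.
[cite: Balaban1983RegularityDecay, Prop. 2.3 of [1] (1.15)–(1.20) p.574] -/
theorem prop23Printed_regularWindow_rot {L : ℕ} (hL : 1 ≤ L) {aminus aplus : ℝ} (ham : 0 < aminus)
    (hle : aminus ≤ aplus) {a' : ℝ} (ha' : 0 < a') {c : ℝ} (hc : 0 ≤ c) {β : ℝ} (hβ : 0 < β) (m2max : ℝ) :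
    B4.Prop23Printed (regularFieldRegionsW (d := d) OrthFlow.rot hL aminus aplus a' c β m2max) :=
  prop23Printed_regularWindow OrthFlow.rot zero_le_one rot_lipschitz hL ham hle ha' hc hβ m2max

/-- **THE WINDOW LEAF FOR THE FLOW `U = e^{tq}` OF (1.2), ANY antisymmetric `q`** (any `N`; r01's `expFlow_lipschitz`).
[cite: Balaban1983RegularityDecay, Prop. 2.3 of [1] (1.15)–(1.20) p.574; (1.2) p.572] -/
theorem prop23Printed_regularWindow_exp (q : Matrix ι ι ℝ) (hq : qᵀ = -q) {L : ℕ} (hL : 1 ≤ L) {aminus aplus : ℝ}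
    (ham : 0 < aminus) (hle : aminus ≤ aplus) {a' : ℝ} (ha' : 0 < a') {c : ℝ} (hc : 0 ≤ c) {β : ℝ} (hβ : 0 < β)
    (m2max : ℝ) : B4.Prop23Printed (regularFieldRegionsW (d := d) (expFlow q hq) hL aminus aplus a' c β m2max) :=
  prop23Printed_regularWindow (expFlow q hq) (expFlow_ell_nonneg q) (expFlow_lipschitz q hq) hL ham hle ha' hc hβ m2max

/-- **B1 PROPOSITION 2.3 (2.33)–(2.38) [Balaban1982Higgs1, pp. 611–612] AT A REGULAR `A ≠ 0`, INTENDED READING, UNIFORMLY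
IN `a_k ∈ [a₋,a₊]`** (r14/pv07's `B1.prop23Intended_iff_prop23Printed`). [cite: Balaban1982Higgs1, Prop. 2.3 (2.33)–(2.38) pp.611–612] -/
theorem prop23Intended_regularWindow (F : OrthFlow ι) {ℓ : ℝ} (hℓ : 0 ≤ ℓ)
    (hLip : ∀ t (v : ι → ℝ), ((F.U t - 1) *ᵥ v) ⬝ᵥ ((F.U t - 1) *ᵥ v) ≤ (ℓ * t) ^ 2 * (v ⬝ᵥ v))
    {L : ℕ} (hL : 1 ≤ L) {aminus aplus : ℝ} (ham : 0 < aminus) (hle : aminus ≤ aplus) {a' : ℝ} (ha' : 0 < a')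
    {c : ℝ} (hc : 0 ≤ c) {β : ℝ} (hβ : 0 < β) (m2max : ℝ) :
    B1.Prop23Intended (regularFieldRegionsW (d := d) F hL aminus aplus a' c β m2max) :=
  (B1.prop23Intended_iff_prop23Printed _).2 (prop23Printed_regularWindow F hℓ hLip hL ham hle ha' hc hβ m2max)

/-- B1's Prop. 2.3, intended reading, window-uniform, for the flow `U = e^{tq}`, any antisymmetric `q`.
[cite: Balaban1982Higgs1, Prop. 2.3 (2.33)–(2.38) pp.611–612] -/
theorem prop23Intended_regularWindow_exp (q : Matrix ι ι ℝ) (hq : qᵀ = -q) {L : ℕ} (hL : 1 ≤ L) {aminus aplus : ℝ}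
    (ham : 0 < aminus) (hle : aminus ≤ aplus) {a' : ℝ} (ha' : 0 < a') {c : ℝ} (hc : 0 ≤ c) {β : ℝ} (hβ : 0 < β)
    (m2max : ℝ) : B1.Prop23Intended (regularFieldRegionsW (d := d) (expFlow q hq) hL aminus aplus a' c β m2max) :=
  prop23Intended_regularWindow (expFlow q hq) (expFlow_ell_nonneg q) (expFlow_lipschitz q hq) hL ham hle ha' hc hβ m2max

/-- the linear-field instance of file 5 at a given `a_k` of the window. [cite: Balaban1983RegularityDecay, (1.7) p.572, (1.14) p.573] -/
def linIdxW {L : ℕ} {aminus aplus m2max : ℝ} {ak : ℝ} (hak : aminus ≤ ak) (hak' : ak ≤ aplus) {n : ℕ} (hn : 1 ≤ n)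
    {m2 : ℝ} (hm : 0 ≤ m2) (hm' : m2 ≤ m2max) {Zc Z₀c : Finset (Fin (d + 1) → ℤ)} (hsub : Zc ⊆ Z₀c)
    (Λ : Finset (↥(fineDom L Zc) × ι)) (lam e : ℝ) : RegularRegionIdxW d ι L aminus aplus m2max :=
  ⟨ak, hak, hak', linIdx hn hm hm' hsub Λ lam e⟩

/-- **NON-VACUITY**: for EVERY threshold `e₁ > 0`, every `a_k ∈ [a₋,a₊]`, every mesh, mass, nested pair and `Λ`, the
linear-field instance with charge `e₁` and slope `λ = c e₁^{β−1}/n` meets `regular`, `bigBlocks` and `0 < e ≤ e₁`.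
[cite: Balaban1983RegularityDecay, (1.7) p.572] -/
theorem linIdxW_meets (F : OrthFlow ι) {L : ℕ} (hL : 1 ≤ L) {aminus aplus : ℝ} (a' : ℝ) {c : ℝ} (hc : 0 ≤ c)
    (β m2max : ℝ) {ak : ℝ} (hak : aminus ≤ ak) (hak' : ak ≤ aplus) {n : ℕ} (hn : 1 ≤ n) {m2 : ℝ} (hm : 0 ≤ m2)
    (hm' : m2 ≤ m2max) {Zc Z₀c : Finset (Fin (d + 1) → ℤ)} (hsub : Zc ⊆ Z₀c) (Λ : Finset (↥(fineDom L Zc) × ι))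
    {e₁ : ℝ} (he₁ : 0 < e₁) :
    (regularFieldRegionsW F hL aminus aplus a' c β m2max
        (linIdxW hak hak' hn hm hm' hsub Λ (c * e₁ ^ (β - 1) / n) e₁)).regular ∧
      (regularFieldRegionsW F hL aminus aplus a' c β m2max
        (linIdxW hak hak' hn hm hm' hsub Λ (c * e₁ ^ (β - 1) / n) e₁)).bigBlocks ∧
      0 < (regularFieldRegionsW F hL aminus aplus a' c β m2max
        (linIdxW hak hak' hn hm hm' hsub Λ (c * e₁ ^ (β - 1) / n) e₁)).e ∧
      (regularFieldRegionsW F hL aminus aplus a' c β m2max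
        (linIdxW hak hak' hn hm hm' hsub Λ (c * e₁ ^ (β - 1) / n) e₁)).e ≤ e₁ :=
  linIdx_meets F hL ak a' hc β m2max hn hm hm' hsub Λ he₁

end

end Literature.MathematicalPhysics.QuantumFieldTheory.Balaban1983to89.B4Prop23RegularWindow
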